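import Literature.AnabelianGeometry.AbsoluteAnabelian.AutHolomorphicSpaces
import Mathlib.Topology.Connected.TotallyDisconnected
import Mathlib.Topology.Algebra.ConstMulAction
import Mathlib.Data.Finsupp.Basic

/-!
# Co-orientations, co-holomorphicizations and Aut-holomorphic orbispaces
# ([AbsTopIII] Def 2.1 (iii), (iv), Cor 2.3 (i) second sentence, Rmk 2.1.1)

Second file of the statements-first typing (D-0014) of S. Mochizuki, *Topics in absolute
anabelian geometry III*, §2 (bib key `MochizukiAbsTopIII2015`; locators = kurims manuscript pages,
lit key `paper:url-5493eb38cbb7`).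

* Def 2.1 (iii) p.51 — `Orn Z := (connected components of Z) → ℤ`, the module of global sections
  of the (trivial, for orientable `Z`) local system `p ↦ Orn(Z,p) = lim_W π₁(W ∖ {p})^ab` ("a
  direct product of copies of `ℤ`, indexed by the connected components of `Z`") — REAL; the
  homomorphism `Orn(Z) → Orn(Z')` INDUCED by a local isomorphism needs the local degree of a local
  homeomorphism of surfaces (algebraic topology absent from Mathlib): it enters as the INTERFACE
  `OrnFunctor` (over RIEMANN SURFACES, with the sign pinned on RC-holomorphic maps) whose axioms quote
  print; co-oriented maps, pre-co-orientations and co-orientations are definitions relative to it.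
* Def 2.1 (iv) pp.51–52 — co-holomorphic local morphisms and (pre-)co-holomorphicizations,
  relative to the same interface; the concrete criterion `IsCoHolomorphicRS` / `SameHolType`; the
  second sentence of Cor 2.3 (i) p.53 (`TwoCoHolomorphicizations`: co-holomorphic iff same type).
* Rmk 2.1.1 p.52 — Aut-holomorphic ORBISPACES, typed by presentations `[𝕌/Γ]` (`AutHolOrbiPresentation`),
  with `AutHolOrbiPresentation.ofSpace` (trivial group; the morphism axiom is proved).

Deliberately NOT here: Rmk 2.1.2, 2.3.1, 2.3.2 (discussion; 2.3.2 = independence of `𝒰`, `𝒱`),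
Cor 2.4–2.9, Prop 2.5–2.6 (files `HolomorphicCores`, `ArchimedeanReconstruction`).
-/

namespace Literature.AnabelianGeometry.AbsoluteAnabelian

open _root_.TopologicalSpace _root_.Topology
open scoped _root_.Manifold _root_.ContDiff

universe u

/-! ### Definition 2.1 (iii): orientations and co-orientations -/

section Orientation

/-- `Orn(Z)`: the module of global sections of the local system `p ↦ Orn(Z,p)` on an orientable
surface `Z` — "a direct product of copies of `ℤ`, indexed by the connected components of `Z`".  We
type the FINITELY SUPPORTED sections `π₀(Z) →₀ ℤ` (= the product whenever `π₀(Z)` is finite, the case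
of the text's surfaces of finite type): the covariant "induced homomorphism" of a local isomorphism
with infinite fibres does not exist on the full product (Specker), and push-forward is what
co-orientation compares (audit A21-F4).
[cite: MochizukiAbsTopIII2015, Definition 2.1 (iii) p.51] -/
abbrev Orn (Z : Type u) [TopologicalSpace Z] : Type u := ConnectedComponents Z →₀ ℤ

/-- **Def 2.1 (iii), interface.**  "One verifies immediately that any local isomorphism `Z → Z'`
induces a well-defined homomorphism `Orn(Z) → Orn(Z')`."  The construction (local degree `±1` of a
local homeomorphism, via `Orn(Z,p) = lim_W π₁(W∖{p})^ab`) is not available in Mathlib; this structure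
records the induced homomorphisms as DATA, for RIEMANN SURFACES only (the spaces of §2; they carry
their complex orientation, so the genuine local-degree functor is a model — over arbitrary spaces no
model distinguishing orientations exists, cf. the Möbius-band review witness), with the axioms:
identity, composition, locality with values `±1` on generators, and the NORMALISATION that pins the
sign on RC-holomorphic maps — `+1` where the map is holomorphic, `−1` where it is anti-holomorphic
(holomorphic maps preserve the complex orientation).  TODO-construct.
[cite: MochizukiAbsTopIII2015, Definition 2.1 (iii) p.51] -/
structure OrnFunctor : Type (u + 1) where
  /-- The homomorphism `Orn(Z₁) → Orn(Z₂)` induced by a local homeomorphism `α : Z₁ → Z₂`. -/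
  induced : ∀ (Z₁ Z₂ : Type u) [TopologicalSpace Z₁] [ChartedSpace ℂ Z₁] [IsManifold 𝓘(ℂ, ℂ) ω Z₁]
    [TopologicalSpace Z₂] [ChartedSpace ℂ Z₂] [IsManifold 𝓘(ℂ, ℂ) ω Z₂] (α : Z₁ → Z₂),
    IsLocalHomeomorph α → (Orn Z₁ →+ Orn Z₂)
  induced_id : ∀ (Z₁ : Type u) [TopologicalSpace Z₁] [ChartedSpace ℂ Z₁] [IsManifold 𝓘(ℂ, ℂ) ω Z₁]
    (h : IsLocalHomeomorph (id : Z₁ → Z₁)), induced Z₁ Z₁ id h = AddMonoidHom.id _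
  induced_comp : ∀ (Z₁ Z₂ Z₃ : Type u) [TopologicalSpace Z₁] [ChartedSpace ℂ Z₁]
    [IsManifold 𝓘(ℂ, ℂ) ω Z₁] [TopologicalSpace Z₂] [ChartedSpace ℂ Z₂] [IsManifold 𝓘(ℂ, ℂ) ω Z₂]
    [TopologicalSpace Z₃] [ChartedSpace ℂ Z₃] [IsManifold 𝓘(ℂ, ℂ) ω Z₃]
    (α : Z₁ → Z₂) (β : Z₂ → Z₃) (hα : IsLocalHomeomorph α)
    (hβ : IsLocalHomeomorph β) (hβα : IsLocalHomeomorph (β ∘ α)),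
    induced Z₁ Z₃ (β ∘ α) hβα = (induced Z₂ Z₃ β hβ).comp (induced Z₁ Z₂ α hα)
  induced_single : ∀ (Z₁ Z₂ : Type u) [TopologicalSpace Z₁] [ChartedSpace ℂ Z₁]
    [IsManifold 𝓘(ℂ, ℂ) ω Z₁] [TopologicalSpace Z₂] [ChartedSpace ℂ Z₂] [IsManifold 𝓘(ℂ, ℂ) ω Z₂]
    (α : Z₁ → Z₂) (hα : IsLocalHomeomorph α) (z : Z₁), ∃ ε : ℤ, (ε = 1 ∨ ε = -1) ∧
      induced Z₁ Z₂ α hα (Finsupp.single (ConnectedComponents.mk z) 1) =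
        Finsupp.single (ConnectedComponents.mk (α z)) ε
  /-- Normalisation: where `α` is holomorphic the local degree is `+1`. -/
  induced_single_of_isHolAt : ∀ (Z₁ Z₂ : Type u) [TopologicalSpace Z₁] [ChartedSpace ℂ Z₁]
    [IsManifold 𝓘(ℂ, ℂ) ω Z₁] [TopologicalSpace Z₂] [ChartedSpace ℂ Z₂] [IsManifold 𝓘(ℂ, ℂ) ω Z₂]
    (α : Z₁ → Z₂) (hα : IsLocalHomeomorph α) (z : Z₁), IsHolAt α z →
      induced Z₁ Z₂ α hα (Finsupp.single (ConnectedComponents.mk z) 1) =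
        Finsupp.single (ConnectedComponents.mk (α z)) 1
  /-- Normalisation: where `α` is anti-holomorphic the local degree is `−1`. -/
  induced_single_of_isAntiHolAt : ∀ (Z₁ Z₂ : Type u) [TopologicalSpace Z₁] [ChartedSpace ℂ Z₁]
    [IsManifold 𝓘(ℂ, ℂ) ω Z₁] [TopologicalSpace Z₂] [ChartedSpace ℂ Z₂] [IsManifold 𝓘(ℂ, ℂ) ω Z₂]
    (α : Z₁ → Z₂) (hα : IsLocalHomeomorph α) (z : Z₁), IsAntiHolAt α z →
      induced Z₁ Z₂ α hα (Finsupp.single (ConnectedComponents.mk z) 1) =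
        Finsupp.single (ConnectedComponents.mk (α z)) (-1)

variable (O : OrnFunctor.{u}) {Z : Type u} [TopologicalSpace Z] [ChartedSpace ℂ Z]
  [IsManifold 𝓘(ℂ, ℂ) ω Z] {Z' : Type u} [TopologicalSpace Z'] [ChartedSpace ℂ Z'] [IsManifold 𝓘(ℂ, ℂ) ω Z']

/-- Two local isomorphisms `α, β : Z → Z'` are **co-oriented** "if they induce the same
homomorphism `Orn(Z) → Orn(Z')`".
[cite: MochizukiAbsTopIII2015, Definition 2.1 (iii) p.51] -/
def IsCoOriented (α β : Z → Z') (hα : IsLocalHomeomorph α) (hβ : IsLocalHomeomorph β) : Prop :=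
  O.induced Z Z' α hα = O.induced Z Z' β hβ

variable (Z Z') in
/-- A **pre-co-orientation** `ζ : Z → Z'`: "any equivalence class of local isomorphisms `Z → Z'`
relative to the equivalence relation determined by the property of being co-oriented".
[cite: MochizukiAbsTopIII2015, Definition 2.1 (iii) p.51] -/
def PreCoOrientation : Type u :=
  Quot (fun (α β : {f : Z → Z' // IsLocalHomeomorph f}) => IsCoOriented O α.1 β.1 α.2 β.2)

variable (Z Z') in
/-- A **co-orientation** `ζ : Z → Z'`: "any section of the sheafification of [the] pre-sheaf" of
pre-co-orientations on open subsets of `Z` — typed by local representatives on an open cover that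
are co-oriented on (every open subset of) the overlaps; identification of families agreeing on a
common refinement is not performed here.
[cite: MochizukiAbsTopIII2015, Definition 2.1 (iii) p.51] -/
structure CoOrientation : Type (u + 1) where
  /-- Index set of the open cover. -/
  ι : Type u
  /-- The open cover. -/
  cover : ι → Opens Z
  isCover : ∀ z : Z, ∃ i, z ∈ cover i
  /-- A local isomorphism on each member, representing the local pre-co-orientation. -/
  locIso : ∀ i, {f : cover i → Z' // IsLocalHomeomorph f}
  agree : ∀ (i j : ι) (W : Opens Z) (hi : W ≤ cover i) (hj : W ≤ cover j)
    (h₁ : IsLocalHomeomorph (fun w : W => (locIso i).1 ⟨w.1, hi w.2⟩))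
    (h₂ : IsLocalHomeomorph (fun w : W => (locIso j).1 ⟨w.1, hj w.2⟩)),
    IsCoOriented O _ _ h₁ h₂

end Orientation

/-! ### Definition 2.1 (iv): co-holomorphic morphisms and co-holomorphicizations -/

section CoHolomorphic

variable (O : OrnFunctor.{u}) {X : Type u} [TopologicalSpace X] [ChartedSpace ℂ X]
  [IsManifold 𝓘(ℂ, ℂ) ω X] {Y : Type u} [TopologicalSpace Y] [ChartedSpace ℂ Y] [IsManifold 𝓘(ℂ, ℂ) ω Y]

/-- Two (𝒰,𝒱)-local morphisms of Aut-holomorphic spaces `φ₁, φ₂ : 𝕏 → 𝕐` are **co-holomorphic**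
"if `φ₁^top` and `φ₂^top` are co-oriented".
[cite: MochizukiAbsTopIII2015, Definition 2.1 (iv) p.51] -/
def IsCoHolomorphic (A : AutHolStructure X) (B : AutHolStructure Y) (𝒰 : Set (Opens X))
    (𝒱 : Set (Opens Y)) (φ₁ φ₂ : X → Y) : Prop :=
  ∃ (h₁ : IsLocalMorphism A B 𝒰 𝒱 φ₁) (h₂ : IsLocalMorphism A B 𝒰 𝒱 φ₂),
    IsCoOriented O φ₁ φ₂ h₁.isLocalHomeomorph h₂.isLocalHomeomorph

/-- A **pre-co-holomorphicization** `ζ : 𝕏 → 𝕐`: an equivalence class of (𝒰,𝒱)-local morphisms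
under "co-holomorphic".
[cite: MochizukiAbsTopIII2015, Definition 2.1 (iv) p.51] -/
def PreCoHolomorphicization (A : AutHolStructure X) (B : AutHolStructure Y) (𝒰 : Set (Opens X))
    (𝒱 : Set (Opens Y)) : Type u :=
  Quot (fun (φ₁ φ₂ : {f : X → Y // IsLocalMorphism A B 𝒰 𝒱 f}) =>
    IsCoHolomorphic O A B 𝒰 𝒱 φ₁.1 φ₂.1)

/-- **Riemann-surface criterion for co-holomorphicity** (the form in which Cor 2.3 (i) describes
the two co-holomorphicizations): two RC-holomorphic maps `φ₁, φ₂ : X → Y` have the same type —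
holomorphic, resp. anti-holomorphic — at the points of each connected component of `X`, and map
it into the same connected component of `Y`.
[cite: MochizukiAbsTopIII2015, Corollary 2.3 (i) p.53] -/
def IsCoHolomorphicRS (φ₁ φ₂ : X → Y) : Prop :=
  ∀ x x' : X, connectedComponent x = connectedComponent x' →
    connectedComponent (φ₁ x) = connectedComponent (φ₂ x') ∧
      (IsHolAt φ₁ x ↔ IsHolAt φ₂ x')

end CoHolomorphic

/-- Two maps are **of the same type**: both holomorphic at every point, or both anti-holomorphic at
every point. [cite: MochizukiAbsTopIII2015, Corollary 2.3 (i) p.53] -/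
def SameHolType {X₁ X₂ Y : Type u} [TopologicalSpace X₁] [ChartedSpace ℂ X₁] [TopologicalSpace X₂]
    [ChartedSpace ℂ X₂] [TopologicalSpace Y] [ChartedSpace ℂ Y] (φ₁ : X₁ → Y) (φ₂ : X₂ → Y) : Prop :=
  ((∀ x, IsHolAt φ₁ x) ∧ ∀ x, IsHolAt φ₂ x) ∨ ((∀ x, IsAntiHolAt φ₁ x) ∧ ∀ x, IsAntiHolAt φ₂ x)

/-- **Cor 2.3 (i), second sentence**: for CONNECTED Riemann surfaces `X`, `Y`, "there exist precisely
two co-holomorphicizations `𝕏 → 𝕐`, corresponding to the holomorphic and anti-holomorphic local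
isomorphisms from open subsets of `X` to `Y`" — typed (over the orientation interface `O`, whose signs
are pinned on RC-holomorphic maps): two morphisms of Aut-holomorphic spaces `U → Y` from a nonempty
connected open `U ⊆ X` are co-holomorphic iff they are of the same type.  (That both types occur, and
that every such morphism has a type — first sentence + connectedness — are not re-vendored.)  Named
`Prop` fact.
[cite: MochizukiAbsTopIII2015, Corollary 2.3 (i) p.53] -/
def TwoCoHolomorphicizations : Prop :=
  ∀ (O : OrnFunctor.{0}) (X Y : Type) [TopologicalSpace X] [T2Space X] [ConnectedSpace X]
    [ChartedSpace ℂ X] [IsManifold 𝓘(ℂ, ℂ) ω X] [TopologicalSpace Y] [T2Space Y] [ConnectedSpace Y]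
    [ChartedSpace ℂ Y] [IsManifold 𝓘(ℂ, ℂ) ω Y] (U : Opens X), IsConnected (U : Set X) →
    ∀ φ₁ φ₂ : U → Y,
      IsMorphism (AutHolStructure.ofCharted U) (AutHolStructure.ofCharted Y) φ₁ →
      IsMorphism (AutHolStructure.ofCharted U) (AutHolStructure.ofCharted Y) φ₂ →
      (IsCoHolomorphic O (AutHolStructure.ofCharted U) (AutHolStructure.ofCharted Y)
          {V | IsConnected (V : Set U)} {W | IsConnected (W : Set Y)} φ₁ φ₂ ↔ SameHolType φ₁ φ₂)

/-! ### Remark 2.1.1: Aut-holomorphic orbispaces -/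

/-- The identity of `X^top` is a morphism of Aut-holomorphic spaces `𝕏 → 𝕏` (for ANY Aut-holomorphic
structure). [cite: MochizukiAbsTopIII2015, Definition 2.1 (ii) p.51] -/
theorem AutHolStructure.isMorphism_id {X : Type u} [TopologicalSpace X] (A : AutHolStructure X) :
    IsMorphism A A (fun x : X => x) where
  isLocalHomeomorph := (Homeomorph.refl X).isLocalHomeomorph
  map_aut_eq := by
    intro V W _ _ e he
    obtain ⟨V, hV⟩ := V
    obtain ⟨W, hW⟩ := W
    have hVW : V = W := by
      ext x
      constructor
      · intro hx
        have h1 := (e ⟨x, hx⟩).2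
        rwa [he ⟨x, hx⟩] at h1
      · intro hx
        have h1 := (e.symm ⟨x, hx⟩).2
        have h2 := he (e.symm ⟨x, hx⟩)
        rw [e.apply_symm_apply] at h2
        change x = _ at h2
        rwa [← h2] at h1
    subst hVW
    have he1 : e = Homeomorph.refl _ := by
      ext y
      exact he y
    subst he1
    ext φ
    simp only [Subgroup.mem_map, MulEquiv.coe_toMonoidHom]
    constructor
    · rintro ⟨ψ, hψ, rfl⟩
      convert hψ
      ext x
      rfl
    · intro hφ
      exact ⟨φ, hφ, by ext x; rfl⟩

/-- **Rmk 2.1.1: Aut-holomorphic orbispaces, by presentations.**  (The flat name `AutHolOrbispace` is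
the §5 stub of `GaloisTheaters.lean`, seat abc-iut-L4-t3 — carrier + `A_X` + `π₁^∧`; this structure is
the §2 object proper, to which that stub is TODO-merged.)  The notions of Def 2.1 extend to Riemann
orbisurfaces — one-dimensional complex analytic stacks "locally isomorphic to the … stack-theoretic
quotient of a Riemann surface by a finite group of [holomorphic] automorphisms".  Typed by
PRESENTATIONS `[𝕌/Γ]`: a Riemann surface `U` (its Aut-holomorphic structure `ofCharted U`) with a group
`Γ` acting properly discontinuously, with finite stabilisers, by HOLOMORPHIC automorphisms.  This covers
exactly the developable ("good") orbisurfaces — the local finite quotients and the global quotients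
`U^top/Π` of Cor 2.4 (c), 2.7 (all hyperbolic orbicurves) — not e.g. the teardrop.
[cite: MochizukiAbsTopIII2015, Remark 2.1.1 p.52] -/
structure AutHolOrbiPresentation : Type (u + 1) where
  /-- The Riemann surface `U` of the presentation. -/
  U : Type u
  [top : TopologicalSpace U]
  [chart : ChartedSpace ℂ U]
  [manifold : IsManifold 𝓘(ℂ, ℂ) ω U]
  /-- The group `Γ` of the presentation. -/
  Γ : Type u
  [grp : Group Γ]
  [act : MulAction Γ U]
  properlyDiscontinuous : ProperlyDiscontinuousSMul Γ U
  finite_stabilizer : ∀ x : U, (MulAction.stabilizer Γ x : Set Γ).Finite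
  /-- `Γ` acts by holomorphic automorphisms. -/
  isHolAt_smul : ∀ (γ : Γ) (x : U), IsHolAt (fun y : U => γ • y) x
  continuous_smul : ∀ γ : Γ, Continuous (fun x : U => γ • x)

attribute [instance] AutHolOrbiPresentation.top AutHolOrbiPresentation.chart
  AutHolOrbiPresentation.manifold AutHolOrbiPresentation.grp AutHolOrbiPresentation.act

/-- The Aut-holomorphic structure of the presenting Riemann surface.
[cite: MochizukiAbsTopIII2015, Remark 2.1.1 p.52] -/
def AutHolOrbiPresentation.str (X : AutHolOrbiPresentation.{u}) : AutHolStructure X.U :=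
  AutHolStructure.ofCharted X.U

/-- A Riemann surface is an Aut-holomorphic orbispace (trivial group).
[cite: MochizukiAbsTopIII2015, Remark 2.1.1 p.52] -/
def AutHolOrbiPresentation.ofSpace (X : Type u) [TopologicalSpace X] [ChartedSpace ℂ X]
    [IsManifold 𝓘(ℂ, ℂ) ω X] : AutHolOrbiPresentation.{u} where
  U := X
  Γ := PUnit
  act := { smul := fun _ x => x, one_smul := fun _ => rfl, mul_smul := fun _ _ _ => rfl }
  properlyDiscontinuous := ⟨fun _ _ => Set.toFinite _⟩
  finite_stabilizer _ := Set.toFinite _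
  isHolAt_smul _ _ := Filter.Eventually.of_forall fun _ => mdifferentiableAt_id
  continuous_smul _ := continuous_id

end Literature.AnabelianGeometry.AbsoluteAnabelian
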